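import Summits.QuantumFields.YangMills.Theorems.BalabanUVNodesN11TStepBranchSum
import Literature.MathematicalPhysics.QuantumFieldTheory.Balaban1983to89.Node00.TkNoExpansionStepSucc

/-!
# DAG node N11 — THE OLD-INDEX BOOKKEEPING OF THE CHARTED INNER SUM: `{S_j}`-index at length `k+1` = old index × new `S_{k+1}`-choices, the old branch operators read
# only `S|≤k` and `init s′`, the generations above an old branch as ONE ζ-weighted A-integral, def-T's kernel transport additive a.e. over finite sums (IsRT-uniqueness)

HEADER — WORK-UNIT METADATA.  Cell `pub-ymgap`, YM-PLAN Track A (HUMAN RULING D-0062), seat `pub-ymgap-dag-n11-d` (g15; R134 fan-out base seat N11 [B14], strategy s2),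
route `BalabanUVNodes` rev 27, item K1⁸ `StabilityBRunRowsAtRecordR13SepCoPH` = stmt-QuantumFields-26907 (helper lane, `--kind proof --supports 26907 --as helper`,
count-neutral).  [III] = [Balaban1988Convergent].  Sequel of this seat's `…N11TStepBranchSum` (p619836: ★★★★★★ `slotsTOfRecord_succ_ae_eq_TkOfRecord_succ_of_innerSum`) over 11a
`Node00/TkOfRecord` (`admSSeq`, `admSOfRecord`, `tkBranchOfRecord`, `genDataOfRecord`) and this lineage's `Node00/TkNoExpansionStepSucc` (g3: `seq_init_Ω_of_le`,
`seq_init_Λ_of_le`, `genDataOfRecord_congr_seq`, `tkBranchOfRecord_eq_init`).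

WHY THIS FILE.  p619836 closes (O3′) at a history `s′` of length `k+1` modulo ONE summed inner identification `hinnerSum` over the whole `{S_j}`-index of record for ONE inner
reading `Fᵢ` of the graph integrand `w(s′)(U,Ū)·χ_k(init s′)(U)·slot_k(init s′)(U)`.  The supplier meets this PER OLD BRANCH: by Theorem 1's inductive hypothesis at `init s′` (the
level-`k` §2 form) the old slot IS `Σ_{S₀ ∈ admSOfRecord k (init s′)} 𝐓_k(init s′, S₀) e^{A_k(init s′, S₀)}` on the `χ_k`-support, the chart acts on each old-branch piece, and the
new branches above `S₀` are `S₀ ∪ {S_{k+1} = Y}` for the admissible new regions `Y` ((2.1)).  §1: the index of record at length `k+1` is the old index times the `Y`-choices; §2: the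
old branch operator reads `S` only below the top and `s′` only through `init s′`; §2b: the generations above an old branch sum to ONE ζ-weighted A-integral; §3: def-T's
`kernelTransport` is additive over finite sums a.e. (push-forward identity + a.e. uniqueness, NO section integrability); §4: (O3′) on the nose from the level-`k` form at `init s′`,
per-old-branch graph integrability `hG₀`, inner readings `hin₀` and charted identifications `hinner₀` (with the inner `Y`-sum), and p619836's row `hint` — §4 is the SEQUEL FILE
`…N11TStepOldBranchInnerSum` (split for the 400-line rule); this file is its bookkeeping.

WHAT THIS FILE PROVES (0 `def`, 0 `sorry`, standard axioms).  §1 `update_succ_empty_mem_admSSeq_init` · `apply_succ_mem_of_mem_admSSeq_succ` · `update_succ_mem_admSSeq_succ` ·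
★★ `sum_admSSeq_succ` · ★★ `sum_admSOfRecord_succ`.  §2 `genDataOfRecord_congr_S` · ★ `tkBranchOfRecord_congr_S` · ★ `tkBranchOfRecord_update_succ_eq_init`.  §2b
`genDataOfRecord_zeta ∕ _sA ∕ _w` (`rfl`) · `sum_zetaOp_aOp_eq_mul_integral_sum` · ★ `sum_genOp_weights_above_oldBranch_eq`.  §3 ★★ `kernelTransport_finset_sum_ae` (generic carriers; the companion
`kernelTransport_congr_ae` is dag-n11-w2's, `…N11KernelTransportSkewProduct`).  (§4 ★★★★★★ `slotsTOfRecord_succ_ae_eq_TkOfRecord_succ_of_oldBranchInnerSum` is in the sequel file `…N11TStepOldBranchInnerSum`.)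

HONEST FRAMING.  Helper lane of K1⁸; count-neutral; `Finset` ∕ `Function.update` bookkeeping, the tree's a.e. uniqueness lemma `ae_eq_of_forall_integral_mul_eq`, and composition
BY NAME; every inner reading ∕ charted identification ∕ integrability row DISPLAYED; NO chart of Bałaban's, NO Jacobian, NO Gaussian integration, nothing of [I] §2 ∕ [III] §3 ∕
Thm 2 asserted; (B4) ∕ (S-α) ∕ (O3′) NOT closed; N11 NOT discharged; K1⁸ NOT closed, no registered stub touched; counts unmoved (typed 28∕28 · discharged 5∕27 · A 5∕28).
One finite `𝕋⁴_{L^K}` programme at fixed `ε = L^{−K}`; R4 closes only the conditional finite-𝕋⁴ rung `BalabanLadder.UV` — NOT ℝ⁴, NOT OS, NOT a mass gap, NOT Clay.  No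
`sorry`, `axiom`, `def`, `instance`, `notation`.  Sources (SHAPE ∕ bookkeeping only): [III] (2.1) p.254, (2.18) p.257, (2.20)–(2.21) p.258, (3.1) p.264, (3.24)–(3.25) p.270, §3 p.279.
-/

noncomputable section

open MeasureTheory ProbabilityTheory
open scoped ENNReal NNReal BigOperators

namespace Summit.QuantumFields.YangMills.Theorems.BalabanUVNodesN11TStepBranchSumOldIndex

open Literature.MathematicalPhysics.QuantumFieldTheory.Balaban1983to89
open Literature.MathematicalPhysics.QuantumFieldTheory.Balaban1983to89.T4AveragingDisintegration
open Node00 hiding SU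
open Node00.Tk T4Continuum B14.Eq218Concrete
open B10Eq42TorusConstraint (bondsIn)
open T4AdjointCovariance (insA)

/-! ## §1  The `{S_j}`-index at length `k+1` is the old index times the admissible new regions -/

section Index

variable {α : Type*} {D : ℕ → Set (Set α)} {k : ℕ}

/-- Forgetting the top entry of an admissible `{S_j}`-sequence for `s′` (length `k+1`) gives an admissible sequence for `init s′`. [cite: Balaban1988Convergent, (2.1) p.254 (bookkeeping)] -/
theorem update_succ_empty_mem_admSSeq_init [Finite α] (C : ℕ → Set (Set α)) (s : Seq D (k + 1)) {S : ℕ → Set α}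
    (hS : S ∈ admSSeq C (k + 1) s) : Function.update S (k + 1) ∅ ∈ admSSeq C k s.init := by
  rw [mem_admSSeq_iff] at hS ⊢
  obtain ⟨hwin, hoff⟩ := hS
  refine ⟨fun j h1 hj => ?_, fun j hj => ?_⟩
  · have hne : j ≠ k + 1 := by omega
    rw [Function.update_of_ne hne, seq_init_Ω_of_le s hj, seq_init_Λ_of_le s hj]
    exact hwin j h1 (Nat.le_succ_of_le hj)
  · by_cases hjk : j = k + 1
    · subst hjk; exact Function.update_self _ _ _
    · rw [Function.update_of_ne hjk]
      exact hoff j (fun h => hj ⟨h.1, by omega⟩)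

/-- The top entry of an admissible `{S_j}`-sequence for `s′` is an admissible new region: in the S-class, inside `Ω_{k+1} ∩ Λ_{k+1}ᶜ`.
[cite: Balaban1988Convergent, (2.1) p.254 (bookkeeping)] -/
theorem apply_succ_mem_of_mem_admSSeq_succ [Finite α] (C : ℕ → Set (Set α)) (s : Seq D (k + 1)) {S : ℕ → Set α}
    (hS : S ∈ admSSeq C (k + 1) s) : S (k + 1) ∈ C (k + 1) ∧ S (k + 1) ⊆ s.Ω (k + 1) ∩ (s.Λ (k + 1))ᶜ :=
  ((mem_admSSeq_iff C s S).1 hS).1 (k + 1) (Nat.succ_pos k) le_rfl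

/-- An admissible old sequence topped by an admissible new region is admissible for `s′`. [cite: Balaban1988Convergent, (2.1) p.254 (bookkeeping)] -/
theorem update_succ_mem_admSSeq_succ [Finite α] (C : ℕ → Set (Set α)) (s : Seq D (k + 1)) {S₀ : ℕ → Set α} (hS₀ : S₀ ∈ admSSeq C k s.init)
    {Y : Set α} (hYC : Y ∈ C (k + 1)) (hY : Y ⊆ s.Ω (k + 1) ∩ (s.Λ (k + 1))ᶜ) : Function.update S₀ (k + 1) Y ∈ admSSeq C (k + 1) s := by
  rw [mem_admSSeq_iff] at hS₀ ⊢
  obtain ⟨hwin, hoff⟩ := hS₀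
  refine ⟨fun j h1 hj => ?_, fun j hj => ?_⟩
  · by_cases hjk : j = k + 1
    · subst hjk; rw [Function.update_self]; exact ⟨hYC, hY⟩
    · have hj' : j ≤ k := by omega
      rw [Function.update_of_ne hjk, ← seq_init_Ω_of_le s hj', ← seq_init_Λ_of_le s hj']
      exact hwin j h1 hj'
  · have hjk : j ≠ k + 1 := fun h => hj ⟨by omega, by omega⟩
    rw [Function.update_of_ne hjk]
    exact hoff j (fun h => hj ⟨h.1, Nat.le_succ_of_le h.2⟩)

/-- ★★ **THE `{S_j}`-SUM AT LENGTH `k+1` IS THE OLD SUM TIMES THE SUM OVER THE ADMISSIBLE NEW REGIONS**: `Σ_{S ∈ admSSeq C (k+1) s′} f S =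
Σ_{S₀ ∈ admSSeq C k (init s′)} Σ_{Y ∈ C(k+1), Y ⊆ Ω_{k+1} ∩ Λ_{k+1}ᶜ} f (S₀ with S_{k+1} := Y)` (the bijection `S ↦ (S with S_{k+1} := ∅, S_{k+1})`).
[cite: Balaban1988Convergent, (2.1) p.254, (2.18) p.257] -/
theorem sum_admSSeq_succ [Finite α] (C : ℕ → Set (Set α)) (s : Seq D (k + 1)) {β : Type*} [AddCommMonoid β] (f : (ℕ → Set α) → β) :
    ∑ S ∈ admSSeq C (k + 1) s, f S =
      ∑ S₀ ∈ admSSeq C k s.init, ∑ Y ∈ (Set.toFinite {Y : Set α | Y ∈ C (k + 1) ∧ Y ⊆ s.Ω (k + 1) ∩ (s.Λ (k + 1))ᶜ}).toFinset,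
        f (Function.update S₀ (k + 1) Y) := by
  rw [← Finset.sum_product (admSSeq C k s.init) _ (fun p : (ℕ → Set α) × Set α => f (Function.update p.1 (k + 1) p.2))]
  refine Finset.sum_nbij' (fun S => (Function.update S (k + 1) ∅, S (k + 1))) (fun p => Function.update p.1 (k + 1) p.2) ?_ ?_ ?_ ?_ ?_
  · intro S hS
    rw [Finset.mem_product, Set.Finite.mem_toFinset]
    exact ⟨update_succ_empty_mem_admSSeq_init C s hS, apply_succ_mem_of_mem_admSSeq_succ C s hS⟩
  · rintro ⟨S₀, Y⟩ hp
    rw [Finset.mem_product, Set.Finite.mem_toFinset] at hp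
    exact update_succ_mem_admSSeq_succ C s hp.1 hp.2.1 hp.2.2
  · intro S _
    simp only [Function.update_idem, Function.update_eq_self]
  · rintro ⟨S₀, Y⟩ hp
    rw [Finset.mem_product] at hp
    have h0 : S₀ (k + 1) = ∅ := ((mem_admSSeq_iff C s.init S₀).1 hp.1).2 (k + 1) (fun h => absurd h.2 (by omega))
    refine Prod.ext ?_ ?_
    · show Function.update (Function.update S₀ (k + 1) Y) (k + 1) ∅ = S₀
      rw [Function.update_idem, ← h0, Function.update_eq_self]
    · show Function.update S₀ (k + 1) Y (k + 1) = Y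
      exact Function.update_self _ _ _
  · intro S _
    simp only [Function.update_idem, Function.update_eq_self]

end Index

section IndexOfRecord

variable (F : T4Family) {ν : Stage7Numerics} {M : ℕ} {g : ℕ → ℝ} {K k : ℕ}

/-- ★★ **THE `{S_j}`-INDEX OF RECORD AT LENGTH `k+1` IS THE OLD INDEX TIMES THE NEW S-CLASS REGIONS INSIDE `Ω_{k+1} ∩ Λ_{k+1}ᶜ`** (§1 at the S-classes of record).
[cite: Balaban1988Convergent, (2.1) p.254, (2.18) p.257] -/
theorem sum_admSOfRecord_succ (s : SeqOfRecord F ν M g K (k + 1)) {β : Type*} [AddCommMonoid β] (f : (ℕ → Set (Site (F.P K) 0)) → β) :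
    ∑ S ∈ admSOfRecord F ν M g K (k + 1) s, f S =
      ∑ S₀ ∈ admSOfRecord F ν M g K k s.init,
        ∑ Y ∈ (Set.toFinite {Y : Set (Site (F.P K) 0) | Y ∈ SClassOfRecord F ν g K (k + 1) ∧ Y ⊆ s.Ω (k + 1) ∩ (s.Λ (k + 1))ᶜ}).toFinset,
          f (Function.update S₀ (k + 1) Y) :=
  sum_admSSeq_succ _ s f

end IndexOfRecord

/-! ## §2  The old branch operator reads `S` only below the top and `s′` only through `init s′` -/

section Branch

variable {F : T4Family} {N : ℕ} [NeZero N] {V : Type}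
variable (ν : Stage7Numerics) (M : ℕ) (g : ℕ → ℝ) (K : ℕ) (W : TkWeights F N V K)

/-- The generation-`j` data of record read the branch only through `S_{j+1}`. [cite: Balaban1988Convergent, (2.21) p.258 (bookkeeping)] -/
theorem genDataOfRecord_congr_S {n : ℕ} (s : SeqOfRecord F ν M g K n) {S S' : ℕ → Set (Site (F.P K) 0)} (j : ℕ) (h : S (j + 1) = S' (j + 1))
    {hdec : DecidableEq (PBond (F.P K) j)} :
    genDataOfRecord F N V ν M g K W s S j = genDataOfRecord F N V ν M g K W s S' j := by
  unfold genDataOfRecord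
  rw [h]

variable [NormedAddCommGroup V] [InnerProductSpace ℝ V] [FiniteDimensional ℝ V] [MeasurableSpace V] [BorelSpace V]

/-- ★ **`𝐓_i(s′, S)` READS THE BRANCH ONLY BELOW `i`**: two branches agreeing at `S_1, …, S_i` have the same branch operator `𝐓_i` (the ordered product (2.20) of the
generations `j < i`, each reading `S_{j+1}`). [cite: Balaban1988Convergent, (2.20)–(2.21) p.258] -/
theorem tkBranchOfRecord_congr_S {n : ℕ} (s : SeqOfRecord F ν M g K n) {S S' : ℕ → Set (Site (F.P K) 0)} :
    ∀ (i : ℕ), (∀ j, j < i → S (j + 1) = S' (j + 1)) → ∀ (Φ : MultiCfg (F.P K) (SU N) V → ℝ),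
      tkBranchOfRecord F N V ν M g K W s S i Φ = tkBranchOfRecord F N V ν M g K W s S' i Φ
  | 0, _, _ => rfl
  | i + 1, hS, Φ => by
      rw [tkBranchOfRecord_succ, tkBranchOfRecord_succ, tkBranchOfRecord_congr_S s i (fun j hj => hS j (Nat.lt_succ_of_lt hj)) Φ,
        genDataOfRecord_congr_S ν M g K W s i (hS i (Nat.lt_succ_self i))]

/-- ★ **THE OLD BRANCH OPERATOR ABOVE A TOPPED OLD INDEX MEMBER**: for `s′` of length `k+1`, an old member `S₀` and any new region `Y`,
`𝐓_k(s′, S₀ with S_{k+1} := Y) = 𝐓_k(init s′, S₀)` (§2's `S`-congruence below the top, then g3's `tkBranchOfRecord_eq_init`). [cite: Balaban1988Convergent, (2.20)–(2.21) p.258, (3.24) p.270] -/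
theorem tkBranchOfRecord_update_succ_eq_init {k : ℕ} (s : SeqOfRecord F ν M g K (k + 1)) (S₀ : ℕ → Set (Site (F.P K) 0)) (Y : Set (Site (F.P K) 0))
    (Φ : MultiCfg (F.P K) (SU N) V → ℝ) :
    tkBranchOfRecord F N V ν M g K W s (Function.update S₀ (k + 1) Y) k Φ = tkBranchOfRecord F N V ν M g K W s.init S₀ k Φ := by
  rw [tkBranchOfRecord_congr_S ν M g K W s k (fun j hj => Function.update_of_ne (by omega) _ _) Φ]
  exact tkBranchOfRecord_eq_init ν M g K W s S₀ k le_rfl Φ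

end Branch

/-! ## §2b  11a: the projections of the generation data of record (`rfl`), and the sum of the generations above an old branch as ONE ζ-weighted A-integral -/

section AboveOldBranch

variable {F : T4Family} {N : ℕ} [NeZero N] {V : Type}
variable (ν : Stage7Numerics) (M : ℕ) (g : ℕ → ℝ) (K : ℕ) (W : TkWeights F N V K)

/-- The ζ-weight of the generation-`j` data of record is `ζ_j(Ω^c_{j+1})` (`rfl`; independent of the branch). [cite: Balaban1988Convergent, (2.21) p.258 (bookkeeping)] -/
theorem genDataOfRecord_zeta {n : ℕ} (s : SeqOfRecord F ν M g K n) (S : ℕ → Set (Site (F.P K) 0)) (j : ℕ) {hdec : DecidableEq (PBond (F.P K) j)} :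
    (genDataOfRecord F N V ν M g K W s S j).ζ = W.ζ j (s.Ω (j + 1))ᶜ := rfl

/-- The A-bond set of the generation-`j` data of record is the level-`j` bond set of `Λ^c_{j+1} ∩ Ω_{j+1}` (`rfl`; independent of the branch). [cite: Balaban1988Convergent, (2.21) p.258, (3.23) p.270 (bookkeeping)] -/
theorem genDataOfRecord_sA {n : ℕ} (s : SeqOfRecord F ν M g K n) (S : ℕ → Set (Site (F.P K) 0)) (j : ℕ) {hdec : DecidableEq (PBond (F.P K) j)} :
    (genDataOfRecord F N V ν M g K W s S j).sA = (Set.toFinite (bondsIn j ((s.Λ (j + 1))ᶜ ∩ s.Ω (j + 1)))).toFinset := rfl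

/-- The A-weight of the generation-`j` data of record is `χ(Λ^c_{j+1} ∩ Ω_{j+1}, S_{j+1}) e^{−½⟨A_j, 𝒬_j(Λ_{j+1}) A_j⟩}` (`rfl`). [cite: Balaban1988Convergent, (2.21) p.258, (3.23) p.270 (bookkeeping)] -/
theorem genDataOfRecord_w {n : ℕ} (s : SeqOfRecord F ν M g K n) (S : ℕ → Set (Site (F.P K) 0)) (j : ℕ) {hdec : DecidableEq (PBond (F.P K) j)} :
    (genDataOfRecord F N V ν M g K W s S j).w = W.w j (s.Λ (j + 1)) ((s.Λ (j + 1))ᶜ ∩ s.Ω (j + 1)) (S (j + 1)) := rfl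

variable [NormedAddCommGroup V] [InnerProductSpace ℝ V] [FiniteDimensional ℝ V] [MeasurableSpace V] [BorelSpace V]

omit [NeZero N] in
/-- 11a, generic: a FINITE SUM of ζ-weighted A-factors with a COMMON ζ and A-bond set is ONE ζ-weighted A-integral of the summed integrand (`zetaOp_apply`, `aOp_apply`,
`integral_finsetSum` — per-summand integrability displayed). [cite: Balaban1988Convergent, (2.21) p.258 (bookkeeping)] -/
theorem sum_zetaOp_aOp_eq_mul_integral_sum {P : Params} {G : Type} (j : ℕ) [DecidableEq (PBond P j)] (ζ : MultiCfg P G V → ℝ) (sA : Finset (PBond P j))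
    {I : Type*} (ι : Finset I) (w Φ : I → MultiCfg P G V → ℝ) (ω : MultiCfg P G V)
    (hI : ∀ i ∈ ι, Integrable (fun a : ↥sA → V => w i (Function.update ω j (insA sA a (ω j))) * Φ i (Function.update ω j (insA sA a (ω j))))
      (Measure.pi fun _ : ↥sA => (volume : Measure V))) :
    ∑ i ∈ ι, zetaOp ζ (aOp j sA (w i) (Φ i)) ω =
      ζ ω * ∫ a : ↥sA → V, ∑ i ∈ ι, w i (Function.update ω j (insA sA a (ω j))) * Φ i (Function.update ω j (insA sA a (ω j)))
        ∂(Measure.pi fun _ : ↥sA => (volume : Measure V)) := by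
  simp only [zetaOp_apply, aOp_apply]
  rw [← Finset.mul_sum, integral_finsetSum ι hI]

/-- ★ **THE GENERATIONS ABOVE AN OLD BRANCH SUM TO ONE ζ-WEIGHTED A-INTEGRAL** ((2.21) with the `S_{k+1}`-decomposition of (2.1) INSIDE the fluctuation integral): at a
history `s′` of length `k+1`, for the family of new branches `S₀ ∪ {S_{k+1} = Y}` over a finite set of new regions `Y`, operands `Φ_Y` and any configuration `ω`,
`Σ_Y ζ·(aOp k sA w_{S₀,Y} Φ_Y)(ω) = ζ_k(Ω^c_{k+1})(ω) · ∫ dA_k|_{Λ^c_{k+1} ∩ Ω_{k+1}} Σ_Y χ(Λ^c_{k+1} ∩ Ω_{k+1}, Y)(ω_a) e^{−½⟨A, 𝒬_k(Λ_{k+1})A⟩}(ω_a) Φ_Y(ω_a)`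
(per-summand integrability displayed) — the right member of §4's `hinner₀` as ONE fibre integral per old branch. [cite: Balaban1988Convergent, (2.1) p.254, (2.21) p.258, (3.23) p.270] -/
theorem sum_genOp_weights_above_oldBranch_eq {k : ℕ} {hdec : DecidableEq (PBond (F.P K) k)} (s' : SeqOfRecord F ν M g K (k + 1))
    (S₀ : ℕ → Set (Site (F.P K) 0)) (𝒴 : Finset (Set (Site (F.P K) 0))) (Φ : Set (Site (F.P K) 0) → MultiCfg (F.P K) (SU N) V → ℝ)
    (ω : MultiCfg (F.P K) (SU N) V)
    (hI : ∀ Y ∈ 𝒴, Integrable (fun a : ↥(Set.toFinite (bondsIn k ((s'.Λ (k + 1))ᶜ ∩ s'.Ω (k + 1)))).toFinset → V =>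
      W.w k (s'.Λ (k + 1)) ((s'.Λ (k + 1))ᶜ ∩ s'.Ω (k + 1)) Y
          (Function.update ω k (insA (Set.toFinite (bondsIn k ((s'.Λ (k + 1))ᶜ ∩ s'.Ω (k + 1)))).toFinset a (ω k))) *
        Φ Y (Function.update ω k (insA (Set.toFinite (bondsIn k ((s'.Λ (k + 1))ᶜ ∩ s'.Ω (k + 1)))).toFinset a (ω k))))
      (Measure.pi fun _ : ↥(Set.toFinite (bondsIn k ((s'.Λ (k + 1))ᶜ ∩ s'.Ω (k + 1)))).toFinset => (volume : Measure V))) :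
    ∑ Y ∈ 𝒴, zetaOp (genDataOfRecord F N V ν M g K W s' (Function.update S₀ (k + 1) Y) k).ζ
        (aOp k (genDataOfRecord F N V ν M g K W s' (Function.update S₀ (k + 1) Y) k).sA
          (genDataOfRecord F N V ν M g K W s' (Function.update S₀ (k + 1) Y) k).w (Φ Y)) ω =
      W.ζ k (s'.Ω (k + 1))ᶜ ω *
        ∫ a : ↥(Set.toFinite (bondsIn k ((s'.Λ (k + 1))ᶜ ∩ s'.Ω (k + 1)))).toFinset → V,
          ∑ Y ∈ 𝒴, W.w k (s'.Λ (k + 1)) ((s'.Λ (k + 1))ᶜ ∩ s'.Ω (k + 1)) Y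
              (Function.update ω k (insA (Set.toFinite (bondsIn k ((s'.Λ (k + 1))ᶜ ∩ s'.Ω (k + 1)))).toFinset a (ω k))) *
            Φ Y (Function.update ω k (insA (Set.toFinite (bondsIn k ((s'.Λ (k + 1))ᶜ ∩ s'.Ω (k + 1)))).toFinset a (ω k)))
          ∂(Measure.pi fun _ : ↥(Set.toFinite (bondsIn k ((s'.Λ (k + 1))ᶜ ∩ s'.Ω (k + 1)))).toFinset => (volume : Measure V)) := by
  simp only [genDataOfRecord_zeta, genDataOfRecord_sA, genDataOfRecord_w, Function.update_self]
  exact sum_zetaOp_aOp_eq_mul_integral_sum (V := V) k _ _ 𝒴 _ _ ω hI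

end AboveOldBranch

/-! ## §3  def-T's kernel transport is additive over finite sums, a.e., for integrable densities (push-forward identity + a.e. uniqueness) -/

section Additive

variable {α β : Type*} [MeasurableSpace α] [MeasurableSpace β] [StandardBorelSpace β] [Nonempty β]

/-- ★★ **ADDITIVITY OF THE KERNEL TRANSPORT OVER FINITE SUMS, `μ`-a.e.**: for a finite fine carrier `ν`, σ-finite coarse `μ`, measurable `avg` with `ν.map avg ≪ μ` and
`ν`-integrable densities `ρ_i`, `kernelTransport ν μ avg (Σ_i ρ_i) =ᵐ[μ] Σ_i kernelTransport ν μ avg ρ_i` — both sides are `μ`-integrable and pair identically with every bounded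
measurable test function (`integral_kernelTransport_mul`), so the tree's `ae_eq_of_forall_integral_mul_eq` applies; NO section-wise integrability against the conditional law is
needed. [cite: Balaban1988Convergent, (3.1) p.264 (bookkeeping)] -/
theorem kernelTransport_finset_sum_ae (ν : Measure β) [IsFiniteMeasure ν] (μ : Measure α) [SigmaFinite μ] {avg : β → α} (havg : Measurable avg)
    (hac : ν.map avg ≪ μ) {I : Type*} (ι : Finset I) (ρ : I → β → ℝ) (hρ : ∀ i ∈ ι, Integrable (ρ i) ν) :
    kernelTransport ν μ avg (fun x => ∑ i ∈ ι, ρ i x) =ᵐ[μ] fun V => ∑ i ∈ ι, kernelTransport ν μ avg (ρ i) V := by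
  have hsum : Integrable (fun x => ∑ i ∈ ι, ρ i x) ν := integrable_finsetSum ι hρ
  refine ae_eq_of_forall_integral_mul_eq (integrable_kernelTransport ν μ havg hac hsum)
    (integrable_finsetSum ι fun i hi => integrable_kernelTransport ν μ havg hac (hρ i hi)) fun f hf hC => ?_
  obtain ⟨C, hC⟩ := hC
  have hfb : ∀ i ∈ ι, Integrable (fun V => kernelTransport ν μ avg (ρ i) V * f V) μ := fun i hi =>
    (integrable_kernelTransport ν μ havg hac (hρ i hi)).mul_bdd hf.aestronglyMeasurable
      (Filter.Eventually.of_forall fun V => by simpa [Real.norm_eq_abs] using hC V)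
  have hfb' : ∀ i ∈ ι, Integrable (fun U => ρ i U * f (avg U)) ν := fun i hi =>
    (hρ i hi).mul_bdd (hf.comp havg).aestronglyMeasurable
      (Filter.Eventually.of_forall fun U => by simpa [Real.norm_eq_abs] using hC (avg U))
  rw [integral_kernelTransport_mul ν μ havg hac hsum hf hC]
  simp_rw [Finset.sum_mul]
  rw [integral_finsetSum ι hfb, integral_finsetSum ι hfb']
  exact Finset.sum_congr rfl fun i hi => (integral_kernelTransport_mul ν μ havg hac (hρ i hi) hf hC).symm

end Additive

end Summit.QuantumFields.YangMills.Theorems.BalabanUVNodesN11TStepBranchSumOldIndex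

end
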